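import Literature.MathematicalPhysics.QuantumFieldTheory.Balaban1983to89.T3TiltDescent
import Literature.MathematicalPhysics.QuantumFieldTheory.Balaban1983to89.T4TreeGaugeHolonomyLaw
import HarnessLib

/-!
# STUB-MISSTATED certificate for `stub_oneLoopPlumbing` (LINE g17-2, crux stmt-QuantumFields-20520)

Kernel-checked facts behind the verdict «1L4 `OneLoopClustered` (and H4, LFR♯, LFR) are typed on a VERSION»:

* §1 `resDensity_succ_eq_toReal_rnDeriv`: at every tower height `k + 1 ≥ 1` Bałaban's restricted density of the trunk
  (`T3RestrictedUnitDensity.resDensity`, hence `T3TiltDescent.heightDensity` at depth `K − J ≥ 1` via `heightDensity_fieldShift`)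
  is, BY DEFINITION, `ENNReal.toReal` of Mathlib's `Measure.rnDeriv` of a push-forward measure — a `Classical.choose`-selected
  representative of an a.e.-class (Mathlib `Measure.rnDeriv` := `(Classical.choose h.lebesgue_decomposition).2`).
* §2 `fieldMeasure_singleton_SU2`: product Haar on `SU(2)`-valued lattice gauge fields charges no point.
* §3 `exists_version_eq_zero_at`: for EVERY coarse field `V₀` there is a function `g` with ALL the properties the trunk proves about
  `heightDensity` (non-negative, measurable, integrable, a.e.-equal to it, and the descended restricted Gibbs measure has density
  `Z_K⁻¹ g` w.r.t. product Haar — the content of `map_descendTo_restrict_eq_withDensity`) and `g V₀ = 0`.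
  Hence no property of `heightDensity` available in the tree can imply `0 < heightDensity … V₀` at a window point, nor any pointwise
  statement about `λ ↦ log heightDensity F (γ/λ) …`; the pointwise clauses of 1L4 speak about the junk freedom of `Classical.choose`.
* §4 `exists_version_positivity_fails`: packaged — a version with every trunk property for which 1L4's positivity clause on the window FAILS (at `U ≡ 1`).

Nothing of Bałaban's is asserted; no summit, no crux, no stub is proved or refuted here. YM mass gap NOT proved.
-/

noncomputable section

open MeasureTheory
open Literature.MathematicalPhysics.QuantumFieldTheory.Balaban1983to89
open Literature.MathematicalPhysics.QuantumFieldTheory.Balaban1983to89.T3ContinuumYM3Torus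
open Literature.MathematicalPhysics.QuantumFieldTheory.Balaban1983to89.T3LevelShift
open Literature.MathematicalPhysics.QuantumFieldTheory.Balaban1983to89.T3UnitLawDensityEML
open Literature.MathematicalPhysics.QuantumFieldTheory.Balaban1983to89.T3UnitScaleTilt
open Literature.MathematicalPhysics.QuantumFieldTheory.Balaban1983to89.T3RestrictedUnitDensity
open Literature.MathematicalPhysics.QuantumFieldTheory.Balaban1983to89.T3TiltDescent
open Literature.MathematicalPhysics.QuantumFieldTheory.Balaban1983to89.Missing
open Literature.MathematicalPhysics.QuantumFieldTheory.Balaban1983to89.T4Continuum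

namespace Summit.QuantumFields.YangMills.Cruxes.FluctuationComparisonRegPrIntL.RunPairOrgan.OneLoop.VersionDependence

/-! ## §1 At depth ≥ 1 the restricted density is a pointwise value of `Measure.rnDeriv` -/

/-- **STRUCTURAL FACT**: `ρ^S_{k+1}(W) = (d(avg_k)_*(ρ^S_k dU)/dV)(W).toReal` with Mathlib's `Measure.rnDeriv` — a chosen version.
[cite: Balaban1985UV3, (2) p.256] -/
theorem resDensity_succ_eq_toReal_rnDeriv (F : T3Family) (γ : ℝ) (K : ℕ)
    (S : Set (GaugeField (F.P K) 0 (Matrix.specialUnitaryGroup (Fin 2) ℂ))) {k : ℕ} (hk : k + 1 ≤ F.m + K)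
    (W : GaugeField (F.P K) (k + 1) (Matrix.specialUnitaryGroup (Fin 2) ℂ)) :
    resDensity F γ K S (k + 1) W =
      ((AveragingRT.pushDensity (BlockAveraging.blockAvg (P := F.P K) (j := k) ℰp).avg (resDensity F γ K S k)).rnDeriv
          (fieldMeasure (F.P K) (k + 1) (Matrix.specialUnitaryGroup (Fin 2) ℂ)) W).toReal := by
  unfold resDensity
  rw [towerDensity_succ F K _ hk]
  show AveragingRT.rnTransport _ _ W = _
  rw [AveragingRT.rnTransport, if_pos (towerDensity_nonneg F K (indicator_boltzmann_nonneg F γ K S) k)]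
  rfl

/-- The same read through `heightDensity`: for `J < K` (so `K − J = k + 1` with `k = K − J − 1`) the height density at the coarse
field `fieldShift W` is the `rnDeriv` value at `W`. [cite: Balaban1985UV3, (2) p.256] -/
theorem heightDensity_fieldShift_eq_toReal_rnDeriv (F : T3Family) (γ : ℝ) {J K : ℕ} (hJK : J ≤ K)
    (S : Set (GaugeField (F.P K) 0 (Matrix.specialUnitaryGroup (Fin 2) ℂ))) {k : ℕ} (hk : K - J = k + 1)
    (W : GaugeField (F.P K) (k + 1) (Matrix.specialUnitaryGroup (Fin 2) ℂ)) :
    heightDensity F γ hJK S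
        (fieldShift (F.sitesPerDir_eq (m := F.m) (K := J) (j := 0) (m' := F.m) (K' := K) (j' := k + 1) (by omega)) W) =
      ((AveragingRT.pushDensity (BlockAveraging.blockAvg (P := F.P K) (j := k) ℰp).avg (resDensity F γ K S k)).rnDeriv
          (fieldMeasure (F.P K) (k + 1) (Matrix.specialUnitaryGroup (Fin 2) ℂ)) W).toReal := by
  have hk' : k + 1 ≤ F.m + K := by omega
  rw [← resDensity_succ_eq_toReal_rnDeriv F γ K S hk' W]
  unfold heightDensity
  -- reindex the tower height `K - J` to `k + 1` along `hk`
  have key : ∀ (a : ℕ) (ha : a = k + 1)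
      (h1 : (F.P K).sitesPerDir a = (F.P J).sitesPerDir 0) (h2 : (F.P J).sitesPerDir 0 = (F.P K).sitesPerDir (k + 1)),
      resDensity F γ K S a (fieldShift h1 (fieldShift h2 W)) = resDensity F γ K S (k + 1) W := by
    intro a ha h1 h2
    subst ha
    rw [fieldShift_fieldShift, fieldShift_refl]
  exact key (K - J) hk _ _

/-! ## §2 Product Haar on `SU(2)` gauge fields charges no point -/

/-- A bond of the finest lattice of the `n`-th approximation (the lattice is three-dimensional and non-empty). [folklore] -/
def someBond (F : T3Family) (n : ℕ) : PBond (F.P n) 0 := ⟨default, ⟨0, by rw [T3Family.P_d]; norm_num⟩⟩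

/-- **PRODUCT HAAR CHARGES NO CONFIGURATION**: `dU{V₀} = 0` on `SU(2)`-valued gauge fields of a non-empty lattice. [folklore] -/
theorem fieldMeasure_singleton_SU2 (F : T3Family) (n : ℕ)
    (V₀ : GaugeField (F.P n) 0 (Matrix.specialUnitaryGroup (Fin 2) ℂ)) :
    fieldMeasure (F.P n) 0 (Matrix.specialUnitaryGroup (Fin 2) ℂ) {V₀} = 0 := by
  haveI := T4TreeGaugeHolonomyLaw.nullSingletonClass_haar_SU2
  haveI : NullSingletonClass (fieldMeasure (F.P n) 0 (Matrix.specialUnitaryGroup (Fin 2) ℂ)) := by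
    unfold fieldMeasure
    exact Measure.pi_nullSingletonClass (someBond F n)
  exact measure_singleton V₀

/-! ## §3 A version with every trunk property of `heightDensity` that vanishes at a prescribed point -/

/-- **VERSION DEPENDENCE OF THE POINTWISE CLAUSES**: for every measurable event `S`, `γ ≥ 0`, `J ≤ K` and EVERY coarse field `V₀`
there is `g ≥ 0`, measurable, integrable, a.e.-equal to `heightDensity F γ hJK S`, with the descended restricted Gibbs measure equal to
`dV.withDensity (Z_K⁻¹ g)` (the full content of `map_descendTo_restrict_eq_withDensity`), and `g V₀ = 0`.  So none of these properties
forces positivity (or any value) of a version at a window point. [cite: Balaban1985UV3, (2) p.256 and (41) p.266] -/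
theorem exists_version_eq_zero_at (F : T3Family) {γ : ℝ} (hγ : 0 ≤ γ) {J K : ℕ} (hJK : J ≤ K)
    {S : Set (GaugeField (F.P K) 0 (Matrix.specialUnitaryGroup (Fin 2) ℂ))} (hS : MeasurableSet S)
    (V₀ : GaugeField (F.P J) 0 (Matrix.specialUnitaryGroup (Fin 2) ℂ)) :
    ∃ g : GaugeField (F.P J) 0 (Matrix.specialUnitaryGroup (Fin 2) ℂ) → ℝ,
      (∀ V, 0 ≤ g V) ∧ Measurable g ∧
      Integrable g (fieldMeasure (F.P J) 0 (Matrix.specialUnitaryGroup (Fin 2) ℂ)) ∧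
      g =ᵐ[fieldMeasure (F.P J) 0 (Matrix.specialUnitaryGroup (Fin 2) ℂ)] heightDensity F γ hJK S ∧
      Measure.map (descendTo F ℰp J K hJK) ((gibbsK F ℰp γ K).restrict S) =
        (fieldMeasure (F.P J) 0 (Matrix.specialUnitaryGroup (Fin 2) ℂ)).withDensity (fun V => ENNReal.ofReal
          ((partitionFn (G := Matrix.specialUnitaryGroup (Fin 2) ℂ) (F.P K) ((F.scheme ℰp γ).β K))⁻¹ * g V)) ∧
      g V₀ = 0 := by
  classical
  haveI : MeasurableSingletonClass (GaugeField (F.P J) 0 (Matrix.specialUnitaryGroup (Fin 2) ℂ)) :=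
    inferInstanceAs (MeasurableSingletonClass (PBond (F.P J) 0 → Matrix.specialUnitaryGroup (Fin 2) ℂ))
  obtain ⟨hm, hi⟩ := heightDensity_props F hJK hS hγ
  set μ := fieldMeasure (F.P J) 0 (Matrix.specialUnitaryGroup (Fin 2) ℂ) with hμ
  let g : GaugeField (F.P J) 0 (Matrix.specialUnitaryGroup (Fin 2) ℂ) → ℝ := ({V₀}ᶜ : Set _).indicator (heightDensity F γ hJK S)
  have hae : g =ᵐ[μ] heightDensity F γ hJK S := by
    have h0 : μ {V₀} = 0 := fieldMeasure_singleton_SU2 F J V₀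
    have : ∀ᵐ V ∂μ, V ∈ (({V₀} : Set _)ᶜ : Set _) := compl_mem_ae_iff.mpr h0
    filter_upwards [this] with V hV
    exact Set.indicator_of_mem hV _
  refine ⟨g, fun V => Set.indicator_nonneg (fun W _ => heightDensity_nonneg F γ hJK S W) V,
    hm.indicator (measurableSet_singleton V₀).compl, hi.congr hae.symm, hae, ?_, ?_⟩
  · rw [map_descendTo_restrict_eq_withDensity F hJK hS hγ]
    refine withDensity_congr_ae ?_
    filter_upwards [hae] with V hV
    rw [hV]
  · exact Set.indicator_of_notMem (fun h : V₀ ∈ ({V₀} : Set _)ᶜ => h rfl) _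

/-! ## §4 The positivity clause of 1L4 fails for such a version at the window point `U ≡ 1` -/

/-- The trivial configuration has trivial plaquette variables (local copy of the one-line fact; the tree's `B15Chi124DetSets.plaqHol_one` sits on a
heavy import chain). [cite: Balaban1985Averaging, (9) p.18] -/
theorem plaqHol_one' {P : Params} {j : ℕ} {G : Type*} [GaugeGroup G] (p : Plaq P j) : GaugeField.plaqHol (1 : GaugeField P j G) p = 1 := by
  show (1 : G) * 1 * (1 : G)⁻¹ * (1 : G)⁻¹ = 1
  simp

/-- `U ≡ 1` lies in every window `{PlaqSmall δ}` with `δ > 0`. [cite: Balaban1985UV3, (7) p.257] -/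
theorem plaqSmall_one {P : Params} {j : ℕ} {G : Type*} [GaugeGroup G] {δ : ℝ} (hδ : 0 < δ) : PlaqSmall δ (1 : GaugeField P j G) := by
  intro p
  rw [plaqHol_one', GaugeGroup.dist1_one]
  exact hδ

/-- **THE POSITIVITY CLAUSE OF 1L4 IS NOT A PROPERTY OF THE A.E.-CLASS**: for every positive threshold `δ` (e.g. `θBal F.L γ b₀ p₀ J`) there is a version `g`
of the restricted density with every trunk property (non-negative, measurable, integrable, a.e.-equal to `heightDensity`, density of the descended restricted
Gibbs measure) for which `∀ U, PlaqSmall δ U → 0 < g U` FAILS (at `U ≡ 1`). [cite: Balaban1985UV3, (2) p.256 and (41) p.266] -/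
theorem exists_version_positivity_fails (F : T3Family) {γ : ℝ} (hγ : 0 ≤ γ) {J K : ℕ} (hJK : J ≤ K)
    {S : Set (GaugeField (F.P K) 0 (Matrix.specialUnitaryGroup (Fin 2) ℂ))} (hS : MeasurableSet S) {δ : ℝ} (hδ : 0 < δ) :
    ∃ g : GaugeField (F.P J) 0 (Matrix.specialUnitaryGroup (Fin 2) ℂ) → ℝ,
      (∀ V, 0 ≤ g V) ∧ Measurable g ∧
      Integrable g (fieldMeasure (F.P J) 0 (Matrix.specialUnitaryGroup (Fin 2) ℂ)) ∧
      g =ᵐ[fieldMeasure (F.P J) 0 (Matrix.specialUnitaryGroup (Fin 2) ℂ)] heightDensity F γ hJK S ∧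
      Measure.map (descendTo F ℰp J K hJK) ((gibbsK F ℰp γ K).restrict S) =
        (fieldMeasure (F.P J) 0 (Matrix.specialUnitaryGroup (Fin 2) ℂ)).withDensity (fun V => ENNReal.ofReal
          ((partitionFn (G := Matrix.specialUnitaryGroup (Fin 2) ℂ) (F.P K) ((F.scheme ℰp γ).β K))⁻¹ * g V)) ∧
      ¬ (∀ U : GaugeField (F.P J) 0 (Matrix.specialUnitaryGroup (Fin 2) ℂ), PlaqSmall δ U → 0 < g U) := by
  obtain ⟨g, h0, hm, hi, hae, hmap, h1⟩ := exists_version_eq_zero_at F hγ hJK hS (1 : GaugeField (F.P J) 0 _)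
  refine ⟨g, h0, hm, hi, hae, hmap, fun h => ?_⟩
  have := h 1 (plaqSmall_one hδ)
  rw [h1] at this
  exact lt_irrefl 0 this

end Summit.QuantumFields.YangMills.Cruxes.FluctuationComparisonRegPrIntL.RunPairOrgan.OneLoop.VersionDependence

end
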